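import Mathlib

/-!
# Short even closed walks in dense edge sets, part 1: breadth-first levels (folklore Moore bound)

An edge set `E ⊆ Sym2 V` (loops allowed) with `|E| ≥ 2 |V|` carries a CLOSED WALK OF EVEN LENGTH
`O(log |V|)` in which some edge is traversed EXACTLY ONCE (`exists_short_even_closed_walk`, in part 2,
`ShortEvenClosedWalk.lean`: length `≤ 4 ⌊log₂ m⌋ + 8 ≤ ⌊log₂ m⌋²` for `|V| ≤ m`, `m ≥ 64`).  The
alternating edge sum of such a walk is a nonzero integer vector of `ℓ¹`-norm `≤ L` in the kernel of
the unsigned incidence matrix of `E` — the form in which "girth `O(log n)` at average degree `> 2`"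
(irregular Moore bound) is used for integer relations among sums of pairs of potentials.

Proof, written with finite sets only (no graph library; compare `GirthBounds.lean`, which vendors
the Moore bound for simple graphs of large girth from Bollobás 1978):
* a nonempty vertex set `S` of minimal size with `|E[S]| ≥ 2|S|` has all `E[S]`-degrees `≥ 3`
  (loops count twice) — part 2;
* breadth-first balls `B k` and levels `L k` from a root `r`, a parent choice `π` (this file):
  an edge is a parent edge `s(π u, u)` (`u` on levels `1 … R`) or a NON-PARENT edge; degree `≥ 3`
  on the levels gives `|L (i+1)| + X_i ≥ 2 |L i|` (`X_i` = non-parent incidences on level `i`,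
  `level_step`), and the non-parent incidences inside the ball of radius `R - 1` are at most twice
  the number of non-parent edges meeting it (`sum_X_le`);
* part 2: hence `|L R| ≥ 2^{R-1}` unless two non-parent edges meet that ball, and each of those closes
  up with two parent chains to a closed walk through `r` of length `≤ 2R` using it exactly once.

All statements are definition-free: the breadth-first data enter as explicit hypotheses
(`hinc`, `hB0`, `hBs`, `hL0`, `hLs`, `hπ`, `hU`, `hPE`), discharged in the final theorem of part 2.
Folklore (irregular Moore bound: Alon–Hoory–Linial 2002; even cycles: Bondy–Simonovits 1974).
-/

namespace Literature.Combinatorics.SimpleGraph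

namespace EvenClosedWalk

open Finset

variable {V : Type*} [DecidableEq V]

/-! ## Incidence numbers `inc v s(x, y) = [x = v] + [y = v]` -/

/-- A vertex not on an edge has incidence number `0`. [folklore] -/
theorem inc_eq_zero_of_not_mem {inc : V → Sym2 V → ℕ}
    (hinc : ∀ v x y, inc v s(x, y) = (if x = v then 1 else 0) + (if y = v then 1 else 0))
    {v : V} {e : Sym2 V} (h : v ∉ e) : inc v e = 0 := by
  induction e using Sym2.ind with
  | _ x y =>
    rw [hinc]
    rw [Sym2.mem_iff] at h
    push Not at h
    simp [Ne.symm h.1, Ne.symm h.2]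

/-- A vertex on an edge has incidence number `≥ 1`. [folklore] -/
theorem one_le_inc_of_mem {inc : V → Sym2 V → ℕ}
    (hinc : ∀ v x y, inc v s(x, y) = (if x = v then 1 else 0) + (if y = v then 1 else 0))
    {v : V} {e : Sym2 V} (h : v ∈ e) : 1 ≤ inc v e := by
  induction e using Sym2.ind with
  | _ x y =>
    rw [hinc]
    rcases Sym2.mem_iff.mp h with rfl | rfl <;> simp

/-- Every edge has total incidence `2`. [folklore] -/
theorem sum_inc_univ [Fintype V] {inc : V → Sym2 V → ℕ}
    (hinc : ∀ v x y, inc v s(x, y) = (if x = v then 1 else 0) + (if y = v then 1 else 0))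
    (e : Sym2 V) : ∑ v, inc v e = 2 := by
  induction e using Sym2.ind with
  | _ x y => simp only [hinc, sum_add_distrib, sum_ite_eq, mem_univ, if_true]

/-- The number of edges of `E` through `v` is at most the degree `Σ_{e ∈ E} inc v e`. [folklore] -/
theorem card_filter_mem_le_deg {inc : V → Sym2 V → ℕ}
    (hinc : ∀ v x y, inc v s(x, y) = (if x = v then 1 else 0) + (if y = v then 1 else 0))
    (E : Finset (Sym2 V)) (v : V) :
    #(E.filter fun e => v ∈ e) ≤ ∑ e ∈ E, inc v e := by
  calc #(E.filter fun e => v ∈ e) = ∑ e ∈ E.filter (fun e => v ∈ e), 1 := card_eq_sum_ones _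
    _ ≤ ∑ e ∈ E.filter (fun e => v ∈ e), inc v e :=
        sum_le_sum fun e he => one_le_inc_of_mem hinc (mem_filter.mp he).2
    _ ≤ ∑ e ∈ E, inc v e := sum_le_sum_of_subset_of_nonneg (filter_subset _ _) fun _ _ _ => Nat.zero_le _

/-! ## Breadth-first balls `B k` and levels `L k`

Hypotheses used below (all discharged in the final theorem):
`hB0 : B 0 = {r}`, `hBs : B (k+1) = B k ∪ {y | ∃ x ∈ B k, s(x, y) ∈ E}`,
`hL0 : L 0 = {r}`, `hLs : L (k+1) = B (k+1) \ B k`. -/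

/-- Balls grow. [folklore] -/
theorem B_mono [Fintype V] {E : Finset (Sym2 V)} {B : ℕ → Finset V}
    (hBs : ∀ k, B (k + 1) = B k ∪ univ.filter fun y => ∃ x ∈ B k, s(x, y) ∈ E)
    {j k : ℕ} (h : j ≤ k) : B j ⊆ B k := by
  induction h with
  | refl => exact Subset.rfl
  | step _ ih => exact ih.trans (by rw [hBs]; exact subset_union_left)

/-- One edge step stays in the next ball. [folklore] -/
theorem mem_B_succ_of_edge [Fintype V] {E : Finset (Sym2 V)} {B : ℕ → Finset V}
    (hBs : ∀ k, B (k + 1) = B k ∪ univ.filter fun y => ∃ x ∈ B k, s(x, y) ∈ E)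
    {k : ℕ} {x y : V} (hx : x ∈ B k) (he : s(x, y) ∈ E) : y ∈ B (k + 1) := by
  rw [hBs, mem_union, mem_filter]
  exact Or.inr ⟨mem_univ _, x, hx, he⟩

/-- Levels lie in balls. [folklore] -/
theorem L_subset_B {r : V} {B L : ℕ → Finset V} (hB0 : B 0 = {r}) (hL0 : L 0 = {r})
    (hLs : ∀ k, L (k + 1) = B (k + 1) \ B k) (k : ℕ) : L k ⊆ B k := by
  cases k with
  | zero => rw [hL0, hB0]
  | succ k => rw [hLs]; exact sdiff_subset

/-- A ball is the union of the levels up to its radius. [folklore] -/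
theorem mem_B_iff [Fintype V] {E : Finset (Sym2 V)} {r : V} {B L : ℕ → Finset V}
    (hB0 : B 0 = {r}) (hBs : ∀ k, B (k + 1) = B k ∪ univ.filter fun y => ∃ x ∈ B k, s(x, y) ∈ E)
    (hL0 : L 0 = {r}) (hLs : ∀ k, L (k + 1) = B (k + 1) \ B k)
    {k : ℕ} {v : V} : v ∈ B k ↔ ∃ j ≤ k, v ∈ L j := by
  induction k with
  | zero => simp [hB0, hL0]
  | succ k ih =>
    constructor
    · intro hv
      by_cases h : v ∈ B k
      · obtain ⟨j, hj, hv'⟩ := ih.mp h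
        exact ⟨j, Nat.le_succ_of_le hj, hv'⟩
      · exact ⟨k + 1, le_rfl, by rw [hLs]; exact mem_sdiff.mpr ⟨hv, h⟩⟩
    · rintro ⟨j, hj, hv⟩
      rcases Nat.lt_or_ge j (k + 1) with hlt | hge
      · exact B_mono hBs (Nat.le_succ k) (ih.mpr ⟨j, Nat.lt_succ_iff.mp hlt, hv⟩)
      · have : j = k + 1 := le_antisymm hj hge
        subst this
        exact L_subset_B hB0 hL0 hLs _ hv

/-- Membership in two levels forces equal indices. [folklore] -/
theorem L_eq_of_mem [Fintype V] {E : Finset (Sym2 V)} {r : V} {B L : ℕ → Finset V}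
    (hB0 : B 0 = {r}) (hBs : ∀ k, B (k + 1) = B k ∪ univ.filter fun y => ∃ x ∈ B k, s(x, y) ∈ E)
    (hL0 : L 0 = {r}) (hLs : ∀ k, L (k + 1) = B (k + 1) \ B k)
    {j k : ℕ} {v : V} (hj : v ∈ L j) (hk : v ∈ L k) : j = k := by
  by_contra h
  wlog hjk : j < k generalizing j k
  · exact this hk hj (Ne.symm h) (lt_of_le_of_ne (Nat.le_of_not_lt hjk) (Ne.symm h))
  obtain ⟨d, rfl⟩ := Nat.exists_eq_add_of_lt hjk
  rw [hLs, mem_sdiff] at hk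
  exact hk.2 (B_mono hBs (by omega) (L_subset_B hB0 hL0 hLs j hj))

/-- Distinct levels are disjoint. [folklore] -/
theorem L_disjoint' [Fintype V] {E : Finset (Sym2 V)} {r : V} {B L : ℕ → Finset V}
    (hB0 : B 0 = {r}) (hBs : ∀ k, B (k + 1) = B k ∪ univ.filter fun y => ∃ x ∈ B k, s(x, y) ∈ E)
    (hL0 : L 0 = {r}) (hLs : ∀ k, L (k + 1) = B (k + 1) \ B k)
    {j k : ℕ} (h : j ≠ k) : Disjoint (L j) (L k) :=
  Finset.disjoint_left.mpr fun _ hj hk => h (L_eq_of_mem hB0 hBs hL0 hLs hj hk)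

/-- Every vertex of level `k + 1` has a neighbour in level `k` (a parent). [folklore] -/
theorem exists_parent [Fintype V] {E : Finset (Sym2 V)} {r : V} {B L : ℕ → Finset V}
    (hB0 : B 0 = {r}) (hBs : ∀ k, B (k + 1) = B k ∪ univ.filter fun y => ∃ x ∈ B k, s(x, y) ∈ E)
    (hL0 : L 0 = {r}) (hLs : ∀ k, L (k + 1) = B (k + 1) \ B k)
    {k : ℕ} {v : V} (hv : v ∈ L (k + 1)) : ∃ x ∈ L k, s(x, v) ∈ E := by
  rw [hLs, mem_sdiff, hBs, mem_union, mem_filter] at hv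
  obtain ⟨hv1, hv2⟩ := hv
  rcases hv1 with h | ⟨-, x, hx, he⟩
  · exact (hv2 h).elim
  refine ⟨x, ?_, he⟩
  cases k with
  | zero => rwa [hL0, ← hB0]
  | succ k =>
    rw [hLs, mem_sdiff]
    exact ⟨hx, fun hx' => hv2 (mem_B_succ_of_edge hBs hx' he)⟩

/-! ## Parent chains (`hπ : v ∈ L (k+1) → π v ∈ L k ∧ s(π v, v) ∈ E`) -/

omit [DecidableEq V] in
/-- Iterated parents descend the levels. [folklore] -/
theorem iterate_mem {E : Finset (Sym2 V)} {L : ℕ → Finset V} {π : V → V}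
    (hπ : ∀ k v, v ∈ L (k + 1) → π v ∈ L k ∧ s(π v, v) ∈ E)
    {k : ℕ} {v : V} (hv : v ∈ L k) {j : ℕ} (hj : j ≤ k) : π^[j] v ∈ L (k - j) := by
  induction j with
  | zero => simpa using hv
  | succ j ih =>
    have h1 := ih (Nat.le_of_succ_le hj)
    have hkj : k - j = (k - (j + 1)) + 1 := by omega
    rw [hkj] at h1
    rw [Function.iterate_succ_apply']
    exact (hπ _ _ h1).1

omit [DecidableEq V] in
/-- The parent chain of a level-`k` vertex reaches the root after `k` steps. [folklore] -/
theorem iterate_eq_root {E : Finset (Sym2 V)} {r : V} {L : ℕ → Finset V} (hL0 : L 0 = {r})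
    {π : V → V} (hπ : ∀ k v, v ∈ L (k + 1) → π v ∈ L k ∧ s(π v, v) ∈ E)
    {k : ℕ} {v : V} (hv : v ∈ L k) : π^[k] v = r := by
  have := iterate_mem hπ hv le_rfl
  rw [Nat.sub_self, hL0, mem_singleton] at this
  exact this

/-- Parent edges of vertices on the levels `1, …, R` are pairwise distinct. [folklore] -/
theorem parentEdge_injOn [Fintype V] {E : Finset (Sym2 V)} {r : V} {B L : ℕ → Finset V}
    (hB0 : B 0 = {r}) (hBs : ∀ k, B (k + 1) = B k ∪ univ.filter fun y => ∃ x ∈ B k, s(x, y) ∈ E)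
    (hL0 : L 0 = {r}) (hLs : ∀ k, L (k + 1) = B (k + 1) \ B k)
    {π : V → V} (hπ : ∀ k v, v ∈ L (k + 1) → π v ∈ L k ∧ s(π v, v) ∈ E) (R : ℕ) :
    Set.InjOn (fun u => s(π u, u)) ↑((range R).biUnion fun k => L (k + 1)) := by
  intro u hu u' hu' h
  simp only [coe_biUnion, coe_range, Set.mem_iUnion, Set.mem_Iio, mem_coe] at hu hu'
  obtain ⟨k, -, hk⟩ := hu
  obtain ⟨k', -, hk'⟩ := hu'
  simp only at h
  rcases Sym2.eq_iff.mp h with ⟨-, h2⟩ | ⟨h1, h2⟩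
  · exact h2
  · -- `π u = u'` and `u = π u'`: levels `k = k' + 1` and `k' = k + 1`, absurd
    have hpu := (hπ k u hk).1
    have hpu' := (hπ k' u' hk').1
    rw [h1] at hpu
    rw [← h2] at hpu'
    have e1 := L_eq_of_mem hB0 hBs hL0 hLs hk' hpu
    have e2 := L_eq_of_mem hB0 hBs hL0 hLs hk hpu'
    omega

/-! ## Level counting

More named data (hypotheses-with-definitions): `hU : U = ⋃_{k<R} L (k+1)` (the levels `1 … R`),
`hPE : PE = U.image (u ↦ s(π u, u))` (parent edges), children `U.filter (π · = v)`. -/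

/-- Children of a level-`i` vertex lie on level `i + 1`. [folklore] -/
theorem children_subset [Fintype V] {E : Finset (Sym2 V)} {r : V} {B L : ℕ → Finset V}
    (hB0 : B 0 = {r}) (hBs : ∀ k, B (k + 1) = B k ∪ univ.filter fun y => ∃ x ∈ B k, s(x, y) ∈ E)
    (hL0 : L 0 = {r}) (hLs : ∀ k, L (k + 1) = B (k + 1) \ B k)
    {π : V → V} (hπ : ∀ k v, v ∈ L (k + 1) → π v ∈ L k ∧ s(π v, v) ∈ E) {R : ℕ} {U : Finset V}
    (hU : U = (range R).biUnion fun k => L (k + 1)) {i : ℕ} {v : V} (hv : v ∈ L i) :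
    U.filter (fun u => π u = v) ⊆ L (i + 1) := by
  intro u hu
  rw [mem_filter, hU, mem_biUnion] at hu
  obtain ⟨⟨k, -, hk⟩, hpu⟩ := hu
  have hk' := (hπ k u hk).1
  rw [hpu] at hk'
  have := L_eq_of_mem hB0 hBs hL0 hLs hv hk'
  subst this
  exact hk

/-- The children of the vertices of one level are at most the next level. [folklore] -/
theorem sum_card_children_le [Fintype V] {E : Finset (Sym2 V)} {r : V} {B L : ℕ → Finset V}
    (hB0 : B 0 = {r}) (hBs : ∀ k, B (k + 1) = B k ∪ univ.filter fun y => ∃ x ∈ B k, s(x, y) ∈ E)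
    (hL0 : L 0 = {r}) (hLs : ∀ k, L (k + 1) = B (k + 1) \ B k)
    {π : V → V} (hπ : ∀ k v, v ∈ L (k + 1) → π v ∈ L k ∧ s(π v, v) ∈ E) {R : ℕ} {U : Finset V}
    (hU : U = (range R).biUnion fun k => L (k + 1)) (i : ℕ) :
    ∑ v ∈ L i, #(U.filter fun u => π u = v) ≤ #(L (i + 1)) := by
  have hdisj : ((L i : Finset V) : Set V).PairwiseDisjoint fun v => U.filter fun u => π u = v := by
    intro v _ v' _ hne
    simp only [Function.onFun]
    rw [Finset.disjoint_left]
    intro u hu hu'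
    exact hne ((mem_filter.mp hu).2.symm.trans (mem_filter.mp hu').2)
  rw [← card_biUnion hdisj]
  refine card_le_card fun u hu => ?_
  obtain ⟨v, hv, hu⟩ := mem_biUnion.mp hu
  exact children_subset hB0 hBs hL0 hLs hπ hU hv hu

/-- Parent edges are edges. [folklore] -/
theorem PE_subset {E : Finset (Sym2 V)} {L : ℕ → Finset V}
    {π : V → V} (hπ : ∀ k v, v ∈ L (k + 1) → π v ∈ L k ∧ s(π v, v) ∈ E) {R : ℕ} {U : Finset V}
    (hU : U = (range R).biUnion fun k => L (k + 1)) {PE : Finset (Sym2 V)}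
    (hPE : PE = U.image fun u => s(π u, u)) : PE ⊆ E := by
  intro e he
  rw [hPE, mem_image] at he
  obtain ⟨u, hu, rfl⟩ := he
  rw [hU, mem_biUnion] at hu
  obtain ⟨k, -, hk⟩ := hu
  exact (hπ k u hk).2

/-- Degree through parent edges: children plus one for the own parent edge. [folklore] -/
theorem sum_inc_PE [Fintype V] {E : Finset (Sym2 V)} {r : V} {B L : ℕ → Finset V}
    (hB0 : B 0 = {r}) (hBs : ∀ k, B (k + 1) = B k ∪ univ.filter fun y => ∃ x ∈ B k, s(x, y) ∈ E)
    (hL0 : L 0 = {r}) (hLs : ∀ k, L (k + 1) = B (k + 1) \ B k)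
    {π : V → V} (hπ : ∀ k v, v ∈ L (k + 1) → π v ∈ L k ∧ s(π v, v) ∈ E)
    {inc : V → Sym2 V → ℕ}
    (hinc : ∀ v x y, inc v s(x, y) = (if x = v then 1 else 0) + (if y = v then 1 else 0))
    {R : ℕ} {U : Finset V} (hU : U = (range R).biUnion fun k => L (k + 1)) {PE : Finset (Sym2 V)}
    (hPE : PE = U.image fun u => s(π u, u)) (v : V) :
    ∑ e ∈ PE, inc v e = #(U.filter fun u => π u = v) + (if v ∈ U then 1 else 0) := by
  rw [hPE, sum_image (by rw [hU]; exact parentEdge_injOn hB0 hBs hL0 hLs hπ R)]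
  simp only [hinc]
  rw [sum_add_distrib, sum_boole, sum_ite_eq', Nat.cast_id]

/-- One breadth-first step: `2 |L i| ≤ |L (i+1)| + X_i` for `1 ≤ i < R`, where `X_i` counts the
non-parent incidences on level `i` (all level-`i` degrees being `≥ 3`). [folklore] -/
theorem level_step [Fintype V] {E : Finset (Sym2 V)} {r : V} {B L : ℕ → Finset V}
    (hB0 : B 0 = {r}) (hBs : ∀ k, B (k + 1) = B k ∪ univ.filter fun y => ∃ x ∈ B k, s(x, y) ∈ E)
    (hL0 : L 0 = {r}) (hLs : ∀ k, L (k + 1) = B (k + 1) \ B k)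
    {π : V → V} (hπ : ∀ k v, v ∈ L (k + 1) → π v ∈ L k ∧ s(π v, v) ∈ E)
    {inc : V → Sym2 V → ℕ}
    (hinc : ∀ v x y, inc v s(x, y) = (if x = v then 1 else 0) + (if y = v then 1 else 0))
    {R : ℕ} {U : Finset V} (hU : U = (range R).biUnion fun k => L (k + 1)) {PE : Finset (Sym2 V)}
    (hPE : PE = U.image fun u => s(π u, u)) {i : ℕ} (hi1 : 1 ≤ i) (hiR : i + 1 ≤ R)
    (hdeg : ∀ v ∈ L i, 3 ≤ ∑ e ∈ E, inc v e) :
    2 * #(L i) ≤ #(L (i + 1)) + ∑ v ∈ L i, ∑ e ∈ E \ PE, inc v e := by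
  have hLU : ∀ v ∈ L i, v ∈ U := fun v hv => by
    rw [hU, mem_biUnion]
    refine ⟨i - 1, mem_range.mpr (by omega), ?_⟩
    rwa [Nat.sub_add_cancel hi1]
  have hdec : ∀ v ∈ L i, ∑ e ∈ E, inc v e =
      #(U.filter fun u => π u = v) + 1 + ∑ e ∈ E \ PE, inc v e := by
    intro v hv
    rw [← sum_sdiff (PE_subset hπ hU hPE), sum_inc_PE hB0 hBs hL0 hLs hπ hinc hU hPE v, if_pos (hLU v hv)]
    ring
  have h3 : 3 * #(L i) ≤ ∑ v ∈ L i, ∑ e ∈ E, inc v e := by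
    rw [mul_comm, card_eq_sum_ones, sum_mul, one_mul]
    exact sum_le_sum hdeg
  rw [sum_congr rfl hdec, sum_add_distrib, sum_add_distrib, sum_const, smul_eq_mul, mul_one] at h3
  have := sum_card_children_le hB0 hBs hL0 hLs hπ hU i
  omega

/-- The first step: `3 ≤ |L 1| + X_0` (the root has degree `≥ 3`). [folklore] -/
theorem level_one [Fintype V] {E : Finset (Sym2 V)} {r : V} {B L : ℕ → Finset V}
    (hB0 : B 0 = {r}) (hBs : ∀ k, B (k + 1) = B k ∪ univ.filter fun y => ∃ x ∈ B k, s(x, y) ∈ E)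
    (hL0 : L 0 = {r}) (hLs : ∀ k, L (k + 1) = B (k + 1) \ B k)
    {π : V → V} (hπ : ∀ k v, v ∈ L (k + 1) → π v ∈ L k ∧ s(π v, v) ∈ E)
    {inc : V → Sym2 V → ℕ}
    (hinc : ∀ v x y, inc v s(x, y) = (if x = v then 1 else 0) + (if y = v then 1 else 0))
    {R : ℕ} {U : Finset V} (hU : U = (range R).biUnion fun k => L (k + 1)) {PE : Finset (Sym2 V)}
    (hPE : PE = U.image fun u => s(π u, u)) (hdeg : 3 ≤ ∑ e ∈ E, inc r e) :
    3 ≤ #(L 1) + ∑ e ∈ E \ PE, inc r e := by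
  have hrU : r ∉ U := by
    rw [hU, mem_biUnion]
    rintro ⟨k, -, hk⟩
    have hr0 : r ∈ L 0 := by rw [hL0]; exact mem_singleton_self r
    have := L_eq_of_mem hB0 hBs hL0 hLs hr0 hk
    omega
  rw [← sum_sdiff (PE_subset hπ hU hPE), sum_inc_PE hB0 hBs hL0 hLs hπ hinc hU hPE r, if_neg hrU] at hdeg
  have hr0 : r ∈ L 0 := by rw [hL0]; exact mem_singleton_self r
  have hC : #(U.filter fun u => π u = r) ≤ #(L 1) :=
    card_le_card (children_subset hB0 hBs hL0 hLs hπ hU hr0)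
  omega

/-- Non-parent incidences inside the ball of radius `R - 1` come from the non-parent edges meeting
that ball (`hNPt` names that set), two per edge at most. [folklore] -/
theorem sum_X_le [Fintype V] {E : Finset (Sym2 V)} {r : V} {B L : ℕ → Finset V}
    (hB0 : B 0 = {r}) (hBs : ∀ k, B (k + 1) = B k ∪ univ.filter fun y => ∃ x ∈ B k, s(x, y) ∈ E)
    (hL0 : L 0 = {r}) (hLs : ∀ k, L (k + 1) = B (k + 1) \ B k)
    {inc : V → Sym2 V → ℕ}
    (hinc : ∀ v x y, inc v s(x, y) = (if x = v then 1 else 0) + (if y = v then 1 else 0))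
    {R : ℕ} (hR : 1 ≤ R) (NP NPt : Finset (Sym2 V))
    (hNPt : ∀ e, e ∈ NPt ↔ e ∈ NP ∧ ∃ v ∈ B (R - 1), v ∈ e) :
    ∑ i ∈ range R, ∑ v ∈ L i, ∑ e ∈ NP, inc v e ≤ 2 * #NPt := by
  have hdisj : ((range R : Finset ℕ) : Set ℕ).PairwiseDisjoint L := fun j _ k _ hne =>
    L_disjoint' hB0 hBs hL0 hLs hne
  have hsub : NPt ⊆ NP := fun e he => ((hNPt e).mp he).1
  -- regroup the sum edge by edge over the ball `W = ⋃_{i<R} L i ⊆ B (R-1)`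
  have hW : ∀ v ∈ (range R).biUnion L, v ∈ B (R - 1) := by
    intro v hv
    obtain ⟨i, hi, hv⟩ := mem_biUnion.mp hv
    exact B_mono hBs (by have := mem_range.mp hi; omega) (L_subset_B hB0 hL0 hLs i hv)
  calc ∑ i ∈ range R, ∑ v ∈ L i, ∑ e ∈ NP, inc v e
      = ∑ e ∈ NP, ∑ v ∈ (range R).biUnion L, inc v e := by
        rw [← sum_biUnion hdisj, sum_comm]
    _ = ∑ e ∈ NP \ NPt, ∑ v ∈ (range R).biUnion L, inc v e +
          ∑ e ∈ NPt, ∑ v ∈ (range R).biUnion L, inc v e := (sum_sdiff hsub).symm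
    _ ≤ 0 + ∑ e ∈ NPt, 2 := by
        gcongr with e he e he
        · refine (sum_eq_zero fun e he => sum_eq_zero fun v hv => ?_).le
          have hne : ¬ ∃ v ∈ B (R - 1), v ∈ e := fun hex =>
            (mem_sdiff.mp he).2 ((hNPt e).mpr ⟨(mem_sdiff.mp he).1, hex⟩)
          exact inc_eq_zero_of_not_mem hinc fun hve => hne ⟨v, hW v hv, hve⟩
        · calc ∑ v ∈ (range R).biUnion L, inc v e ≤ ∑ v, inc v e :=
                sum_le_sum_of_subset_of_nonneg (subset_univ _) fun _ _ _ => Nat.zero_le _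
            _ = 2 := sum_inc_univ hinc e
    _ = 2 * #NPt := by
        rw [zero_add, sum_const, smul_eq_mul, mul_comm]

end EvenClosedWalk

end Literature.Combinatorics.SimpleGraph
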